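import Summits.RiemannHypothesis.RiemannHypothesis.Theorems.GroundBartaPolarPerronFrobeniusOverlapForm
import HarnessLib

/-!
# RH from ground states that do not become orthogonal to the window theta vector
(route `RiemannHypothesis/GroundBarta`, crux `PolarPerronFrobenius` stmt-RiemannHypothesis-18390;
helper — the geometric (`L²`) form of the OVERLAP bridge; RH-free)

Let `θ_a = 𝟙_{(-a,a)}Φ / ‖𝟙_{(-a,a)}Φ‖₂` be the normalised window theta vector (`Φ = weilThetaPhi`,
Riemann's kernel).  For a ground state `u` (so `‖u‖₂ = 1`) the polarisation identity gives
`Re ∫ uΦ = ‖𝟙_{(-a,a)}Φ‖₂ (1 − ‖u − θ_a‖₂²/2)` (`thetaClose_re_overlap_eq`).  Hence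
(`riemannHypothesis_of_cofinal_thetaClose`): **if for some `δ` with `δ² < 2` there are, beyond every
height, a window `a` and a ground state `u` at `a` with `‖u − θ_a‖₂ ≤ δ`, then the Riemann
Hypothesis holds** — `√2` being the distance between orthogonal unit vectors, the hypothesis says
exactly that the ground states do not become asymptotically orthogonal to Riemann's kernel; under
`¬RH` they do (`eventually_thetaDist_of_not_riemannHypothesis`).  A fixed-precision, parity-free,
simplicity-free, limit-free substitute for CCM25's `k_λ ≈ ξ_λ` (§7) as far as RH is concerned;
compare `GroundStatesConvergeToXi.riemannHypothesis_of_tendsto_integral_norm_sq_sub_phi` (route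
WeilGroundState: `L²`-CONVERGENCE of renormalised ground states to `Φ` along some windows ⇒ RH).
RH-free; no definitions.
-/

set_option linter.dupNamespace false

noncomputable section

open Set MeasureTheory Filter Complex
open scoped Real Topology ComplexConjugate

namespace Summit.RiemannHypothesis.RiemannHypothesis.Theorems.GroundBartaFloor

open Literature.NumberTheory.LFunctions
open Summit.RiemannHypothesis.RiemannHypothesis.Theorems.GroundStatesConvergeToXi

/-! ## The window theta mass `N_a² = ∫_{(-a,a)} Φ²` -/

/-- `Φ²` is integrable on every window. [folklore] -/
theorem thetaClose_integrableOn_sq (a : ℝ) :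
    IntegrableOn (fun s => weilThetaPhi s ^ 2) (Ioo (-a) a) :=
  ((continuous_weilThetaPhi.pow 2).continuousOn).integrableOn_Icc.mono_set Ioo_subset_Icc_self

/-- `N_a² ≥ N_1² ≥ 2Φ(1)² > 0` for `a ≥ 1`. [folklore] -/
theorem thetaClose_mass_ge {a : ℝ} (ha : 1 ≤ a) :
    2 * weilThetaPhi 1 ^ 2 ≤ ∫ s in Ioo (-a) a, weilThetaPhi s ^ 2 := by
  have h1 : ∫ s in Ioo (-1 : ℝ) 1, weilThetaPhi 1 ^ 2 ≤ ∫ s in Ioo (-1 : ℝ) 1, weilThetaPhi s ^ 2 := by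
    refine setIntegral_mono_on (integrableOn_const measure_Ioo_lt_top.ne)
      (thetaClose_integrableOn_sq 1) measurableSet_Ioo fun s hs => ?_
    exact pow_le_pow_left₀ (weilThetaPhi_pos 1).le
      (gbf_weilThetaPhi_le_of_abs_le (abs_le.2 ⟨hs.1.le, hs.2.le⟩)) 2
  have h2 : ∫ s in Ioo (-1 : ℝ) 1, weilThetaPhi s ^ 2 ≤ ∫ s in Ioo (-a) a, weilThetaPhi s ^ 2 :=
    setIntegral_mono_set (thetaClose_integrableOn_sq a) (ae_of_all _ fun s => sq_nonneg _)
      (Ioo_subset_Ioo (by linarith) ha).eventuallyLE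
  have h0 : ∫ s in Ioo (-1 : ℝ) 1, weilThetaPhi 1 ^ 2 = 2 * weilThetaPhi 1 ^ 2 := by
    rw [setIntegral_const, Real.volume_real_Ioo_of_le (by norm_num), smul_eq_mul]; ring
  linarith

/-! ## Polarisation: `Re ∫ uΦ = N_a (1 − ‖u − θ_a‖₂²/2)` -/

/-- For a complex `z` and a real `r`: `‖z − r‖² = ‖z‖² − 2 r Re z + r²`. [folklore] -/
theorem thetaClose_normSq_sub_real (z : ℂ) (r : ℝ) :
    ‖z - (r : ℂ)‖ ^ 2 = ‖z‖ ^ 2 - 2 * r * z.re + r ^ 2 := by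
  rw [Complex.sq_norm, Complex.sq_norm, Complex.normSq_apply, Complex.normSq_apply]
  simp only [Complex.sub_re, Complex.ofReal_re, Complex.sub_im, Complex.ofReal_im, sub_zero]
  ring

/-- **Polarisation identity for a ground state against the window theta vector**:
`Re ∫ uΦ = N_a · (1 − (1/2)∫‖u − θ_a‖²)`, `θ_a = 𝟙_{(-a,a)}Φ/N_a`, `N_a = √(∫_{(-a,a)}Φ²)`, `a ≥ 1`.
[folklore] -/
theorem thetaClose_re_overlap_eq {a : ℝ} (ha : 1 ≤ a) {u : ℝ → ℂ} (hu : IsWeilGroundState a u) :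
    (∫ t, u t * ((weilThetaPhi t : ℝ) : ℂ)).re =
      Real.sqrt (∫ s in Ioo (-a) a, weilThetaPhi s ^ 2) *
        (1 - (1 / 2) * ∫ t, ‖u t - (((Ioo (-a) a).indicator weilThetaPhi t /
          Real.sqrt (∫ s in Ioo (-a) a, weilThetaPhi s ^ 2) : ℝ) : ℂ)‖ ^ 2) := by
  obtain ⟨hu2, -⟩ := id hu
  set M : ℝ := ∫ s in Ioo (-a) a, weilThetaPhi s ^ 2 with hM
  set N : ℝ := Real.sqrt M with hN
  have hM0 : 0 < M :=
    lt_of_lt_of_le (mul_pos two_pos (pow_pos (weilThetaPhi_pos 1) 2)) (thetaClose_mass_ge ha)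
  have hN0 : 0 < N := Real.sqrt_pos.2 hM0
  have hNsq : N ^ 2 = M := Real.sq_sqrt hM0.le
  set θ : ℝ → ℝ := fun t => (Ioo (-a) a).indicator weilThetaPhi t / N with hθ
  have hθ_out : ∀ t, t ∉ Ioo (-a) a → θ t = 0 := fun t ht => by
    simp only [hθ, indicator_of_notMem ht, zero_div]
  have hθ_in : ∀ t, t ∈ Ioo (-a) a → θ t = weilThetaPhi t / N := fun t ht => by
    simp only [hθ, indicator_of_mem ht]
  have hθ_bd : ∀ t, |θ t| ≤ weilThetaPhi 0 / N := fun t => by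
    by_cases ht : t ∈ Ioo (-a) a
    · rw [hθ_in t ht, abs_of_nonneg (div_nonneg (weilThetaPhi_pos t).le hN0.le)]
      exact div_le_div_of_nonneg_right (gbf_weilThetaPhi_le_zero_val t) hN0.le
    · rw [hθ_out t ht, abs_zero]; exact div_nonneg (weilThetaPhi_pos 0).le hN0.le
  have hθ_meas : AEStronglyMeasurable θ volume :=
    ((continuous_weilThetaPhi.measurable.indicator measurableSet_Ioo).div_const N).aestronglyMeasurable
  -- (1) `∫ θ² = 1`
  have hθsq : ∫ t, θ t ^ 2 = 1 := by
    have e : (fun t => θ t ^ 2) = (Ioo (-a) a).indicator fun t => weilThetaPhi t ^ 2 / M := by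
      funext t
      by_cases ht : t ∈ Ioo (-a) a
      · rw [hθ_in t ht, indicator_of_mem ht, div_pow, hNsq]
      · rw [hθ_out t ht, indicator_of_notMem ht]; ring
    rw [e, integral_indicator measurableSet_Ioo]
    have : ∫ t in Ioo (-a) a, weilThetaPhi t ^ 2 / M = (∫ t in Ioo (-a) a, weilThetaPhi t ^ 2) / M :=
      integral_div M _
    rw [this, ← hM, div_self hM0.ne']
  -- (2) integrability
  have husq : Integrable fun t => ‖u t‖ ^ 2 := (memLp_two_iff_integrable_sq_norm hu2.1).1 hu2
  have hθsq_int : Integrable fun t => θ t ^ 2 := by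
    refine Integrable.mono' ((integrableOn_const (measure_Ioo_lt_top (a := -a) (b := a)).ne
      (C := weilThetaPhi 0 ^ 2 / M)).integrable_indicator measurableSet_Ioo)
      (hθ_meas.pow 2) (ae_of_all _ fun t => ?_)
    by_cases ht : t ∈ Ioo (-a) a
    · rw [indicator_of_mem ht, Real.norm_eq_abs, abs_of_nonneg (sq_nonneg _), hθ_in t ht, div_pow,
        hNsq]
      exact div_le_div_of_nonneg_right
        (pow_le_pow_left₀ (weilThetaPhi_pos t).le (gbf_weilThetaPhi_le_zero_val t) 2) hM0.le
    · rw [indicator_of_notMem ht, hθ_out t ht]; simp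
  have hcross_int : Integrable fun t => θ t * (u t).re := by
    refine Integrable.mono' (hu.integrable.norm.const_mul (weilThetaPhi 0 / N))
      (hθ_meas.mul (Complex.continuous_re.comp_aestronglyMeasurable hu2.1))
      (ae_of_all _ fun t => ?_)
    rw [Real.norm_eq_abs, abs_mul]
    exact mul_le_mul (hθ_bd t) (Complex.abs_re_le_norm _) (abs_nonneg _)
      (div_nonneg (weilThetaPhi_pos 0).le hN0.le)
  -- (3) polarisation
  have hpol : ∫ t, ‖u t - ((θ t : ℝ) : ℂ)‖ ^ 2 = 2 - 2 * ∫ t, θ t * (u t).re := by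
    have e : (fun t => ‖u t - ((θ t : ℝ) : ℂ)‖ ^ 2) =
        fun t => (‖u t‖ ^ 2 - 2 * (θ t * (u t).re)) + θ t ^ 2 := by
      funext t; rw [thetaClose_normSq_sub_real]; ring
    have i1 : ∫ t, ((‖u t‖ ^ 2 - 2 * (θ t * (u t).re)) + θ t ^ 2) =
        (∫ t, (‖u t‖ ^ 2 - 2 * (θ t * (u t).re))) + ∫ t, θ t ^ 2 :=
      integral_add (husq.sub (hcross_int.const_mul 2)) hθsq_int
    have i2 : ∫ t, (‖u t‖ ^ 2 - 2 * (θ t * (u t).re)) =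
        (∫ t, ‖u t‖ ^ 2) - ∫ t, 2 * (θ t * (u t).re) := integral_sub husq (hcross_int.const_mul 2)
    have i3 : ∫ t, 2 * (θ t * (u t).re) = 2 * ∫ t, θ t * (u t).re := integral_const_mul _ _
    rw [e, i1, i2, i3, hu.integral_norm_sq, hθsq]
    ring
  -- (4) `∫ θ Re u = (Re ∫ uΦ)/N`
  have hnull : (volume : Measure ℝ) {-a, a} = 0 := (Set.toFinite _).measure_zero volume
  have hae2 := measure_eq_zero_iff_ae_notMem.1 hnull
  have hcross : ∫ t, θ t * (u t).re = (∫ t, u t * ((weilThetaPhi t : ℝ) : ℂ)).re / N := by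
    have hint : Integrable fun t => u t * ((weilThetaPhi t : ℝ) : ℂ) :=
      hu.integrable_mul_continuous (continuous_ofReal.comp continuous_weilThetaPhi)
    have h1 : (∫ t, u t * ((weilThetaPhi t : ℝ) : ℂ)).re = ∫ t, (u t).re * weilThetaPhi t := by
      have h0 := integral_re hint
      simp only [RCLike.re_to_complex] at h0
      rw [← h0]
      refine integral_congr_ae (ae_of_all _ fun t => ?_)
      simp only [Complex.mul_re, Complex.ofReal_re, Complex.ofReal_im, mul_zero, sub_zero]
    rw [h1, eq_div_iff hN0.ne', ← integral_mul_const]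
    refine integral_congr_ae ?_
    filter_upwards [hu.ae_eq_zero_of_notMem, hae2] with t h2 h3
    by_cases ht : t ∈ Ioo (-a) a
    · rw [hθ_in t ht]; field_simp
    · have hm : t ∉ Icc (-a) a := by
        intro hm
        simp only [mem_insert_iff, mem_singleton_iff, not_or] at h3
        exact ht ⟨lt_of_le_of_ne hm.1 (fun h => h3.1 h.symm), lt_of_le_of_ne hm.2 h3.2⟩
      rw [hθ_out t ht, h2 hm]; simp
  -- assemble
  have hre : (∫ t, u t * ((weilThetaPhi t : ℝ) : ℂ)).re = N * ∫ t, θ t * (u t).re := by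
    rw [hcross]; field_simp
  rw [hre, hpol]
  ring

/-! ## RH from `‖u − θ_a‖ ≤ δ < √2` cofinally -/

/-- **RH from non-orthogonality to the window theta vector, cofinally.**  If `δ² < 2` and beyond
every height there are a window `a` and a ground state `u` at `a` with `∫‖u − θ_a‖² ≤ δ²`
(`θ_a = 𝟙_{(-a,a)}Φ/‖𝟙_{(-a,a)}Φ‖₂`), then the Riemann Hypothesis holds:
`Re ∫ uΦ ≥ N_1(1 − δ²/2) > 0`, and `riemannHypothesis_of_cofinal_thetaOverlap` applies. [folklore] -/
theorem riemannHypothesis_of_cofinal_thetaClose {δ : ℝ} (hδ : δ ^ 2 < 2)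
    (h : ∀ A : ℝ, ∃ a : ℝ, A ≤ a ∧ ∃ u : ℝ → ℂ, IsWeilGroundState a u ∧
      ∫ t, ‖u t - (((Ioo (-a) a).indicator weilThetaPhi t /
          Real.sqrt (∫ s in Ioo (-a) a, weilThetaPhi s ^ 2) : ℝ) : ℂ)‖ ^ 2 ≤ δ ^ 2) :
    RiemannHypothesis := by
  set L : ℝ := Real.sqrt (2 * weilThetaPhi 1 ^ 2) * (1 - δ ^ 2 / 2) with hL
  have hΦ1 := weilThetaPhi_pos 1
  have hL0 : 0 < L := mul_pos (Real.sqrt_pos.2 (by positivity)) (by linarith)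
  refine riemannHypothesis_of_cofinal_thetaOverlap hL0 fun A => ?_
  obtain ⟨a, ha, u, hu, hclose⟩ := h (max A 1)
  have haA : A ≤ a := (le_max_left _ _).trans ha
  have ha1 : 1 ≤ a := (le_max_right _ _).trans ha
  refine ⟨a, haA, u, hu, ?_⟩
  have hre := thetaClose_re_overlap_eq ha1 hu
  have hNa : Real.sqrt (2 * weilThetaPhi 1 ^ 2) ≤ Real.sqrt (∫ s in Ioo (-a) a, weilThetaPhi s ^ 2) :=
    Real.sqrt_le_sqrt (thetaClose_mass_ge ha1)
  have hfac : 1 - δ ^ 2 / 2 ≤ 1 - (1 / 2) * ∫ t, ‖u t - (((Ioo (-a) a).indicator weilThetaPhi t /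
      Real.sqrt (∫ s in Ioo (-a) a, weilThetaPhi s ^ 2) : ℝ) : ℂ)‖ ^ 2 := by linarith
  have hfac0 : 0 ≤ 1 - δ ^ 2 / 2 := by linarith
  have hexp : Real.exp (-Real.exp a) ≤ 1 := Real.exp_le_one_iff.2 (by linarith [Real.exp_pos a])
  calc L * Real.exp (-Real.exp a) ≤ L * 1 := mul_le_mul_of_nonneg_left hexp hL0.le
    _ = Real.sqrt (2 * weilThetaPhi 1 ^ 2) * (1 - δ ^ 2 / 2) := by rw [mul_one]
    _ ≤ Real.sqrt (∫ s in Ioo (-a) a, weilThetaPhi s ^ 2) *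
          (1 - (1 / 2) * ∫ t, ‖u t - (((Ioo (-a) a).indicator weilThetaPhi t /
            Real.sqrt (∫ s in Ioo (-a) a, weilThetaPhi s ^ 2) : ℝ) : ℂ)‖ ^ 2) :=
        mul_le_mul hNa hfac hfac0 (Real.sqrt_nonneg _)
    _ = (∫ t, u t * ((weilThetaPhi t : ℝ) : ℂ)).re := hre.symm
    _ ≤ ‖∫ t, u t * ((weilThetaPhi t : ℝ) : ℂ)‖ := Complex.re_le_norm _

/-- **Under `¬RH` the ground states become orthogonal to the window theta vector**: for every
`δ` with `δ² < 2`, beyond some height EVERY ground state has `∫‖u − θ_a‖² > δ²`. [folklore] -/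
theorem eventually_thetaDist_of_not_riemannHypothesis (hRH : ¬ RiemannHypothesis) {δ : ℝ}
    (hδ : δ ^ 2 < 2) :
    ∃ A : ℝ, ∀ a : ℝ, A ≤ a → ∀ u : ℝ → ℂ, IsWeilGroundState a u →
      δ ^ 2 < ∫ t, ‖u t - (((Ioo (-a) a).indicator weilThetaPhi t /
          Real.sqrt (∫ s in Ioo (-a) a, weilThetaPhi s ^ 2) : ℝ) : ℂ)‖ ^ 2 := by
  by_contra h
  push Not at h
  exact hRH (riemannHypothesis_of_cofinal_thetaClose hδ fun A => by
    obtain ⟨a, ha, u, hu, hd⟩ := h A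
    exact ⟨a, ha, u, hu, hd⟩)

end Summit.RiemannHypothesis.RiemannHypothesis.Theorems.GroundBartaFloor

end
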